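import Summits.QuantumFields.BalabanUV.T4Continuum.Support.ShellMeasureLandauEndFinalToy
import Summits.QuantumFields.BalabanUV.T4Continuum.Support.ShellMeasureLevelZeroShellMass

/-!
# `T4Continuum.ShellMeasureLandauEndFinalToyMass` — row S88 f2 «THE MEASURE HALF»: the law of ONE plaquette variable
# under product Haar IS Haar, so the END-II-final toy's realized shell mass is a ONE-LINK Haar mass — POSITIVE (and a typed
# remark: at the certified numbers `D·ρ ≥ 1`, so the (M1) INEQUALITY there is automatic — the content is the live shell)
(cell `pub-balaban`, sub-cell `t4`, spine estimate NE7c (node U5b); NE7c ROUND-2 crew, unit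
`b2b-balaban-t4-ne7c-formalise-leaf-04` gen 8 — file 2 of row S88 of `t4/b2b-balaban-t4-ne7c-p1/LEAVES-NE7c-P1.md` (S88 f1 =
`ShellMeasureLandauEndFinalToy` p229790, XREAD C-ne7cleaf08-44 INFO-3 «§5 gives `θ < 2 sin(S∕2)`, not `μ(shell) > 0`»; the typer's
acceptance clause «realized shell mass POSITIVE»); ADDITIVE — imports S88 f1 and S89 f2 `ShellMeasureLevelZeroShellMass` (p230020;
its `SU(2)` lemmas `isOpen_dist1_lt`, `exists_dist1_eq`, `haar_pos_of_isOpen`, `continuous_dist1_su2` BY NAME) ONLY; [folklore];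
0 `def`, 0 `def … : Prop`, 0 sorry, 0 citation)

HONEST FRAMING.  ELEMENTARY measure theory on OUR realized objects (product Haar on `SU(2)`, the toy density `F = 𝟙[dist1 U(∂p)
≤ 2 sin(S∕2)]` and classifier `u = dist1 U(∂p)` of S88): nothing of Bałaban's, no estimate, nothing printed asserted or cited.
Finite four-torus programme, rung (B)+1 only — NOT infinite volume, NOT a mass gap, NOT the Clay problem, NOT summit progress;
NE7c (`T4IndicatorShell.ShellWeightBound`) NOT PRINTED, NOT PROVED; «NE7c ⇐ the named binders» (c3); (M1) realized on a toy ≠ NE7c.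

THE POINT, in three sentences.  (§0, `slotAntiConcentration_of_one_le_mul`) (M1) `μ{θ(1−ρ) ≤ u < θ} ≤ D·ρ·μ(univ)` is implied by
monotonicity whenever `1 ≤ D·ρ` — and the G-1 certificates fire the ENDs at `ρ = ¼` with `D = 2(m₀ + …)∕(1 − ½) ≥ 4m₀ ≥ 12`
(S88: `m₀ = 3`, `D·ρ = 3`; S89: `D ≥ 4·#(Λ × Fin 3)`, `D·ρ ≥ 3`), so what they certify is the JOINT INHABITATION of the binder
families (their purpose, crew rule G-1), not an informative inequality.  (§1–§2) The realized law IS computable here: under the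
product Haar measure `dU` of ANY torus of the cell the law of ONE plaquette variable `U(∂p)` is the Haar measure of `SU(2)`
(`fieldMeasure_plaqHol_mem`, `map_plaqHol_fieldMeasure`: slice along the first letter `b₁ = ⟨x, μ⟩` — `U(∂p) = U(b₁)·staple`,
the staple blind to `U(b₁)` because the four letters are pairwise distinct (`T4WilsonLinkAffine`), the slice of the event a
right translate of the one-link event, `HaarData.map_mul_right`, Mathlib's `lintegral_eq_of_lmarginal_eq`), hence for
`0 < S ≤ 10⁻⁵` (S88 §5: the threshold `θ = εθ·1²` sits inside the window, where `F = 1`) the toy's realized masses are ONE-LINK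
class masses — `μ_F{θ(1−ρ) ≤ u < θ} = haar{θ(1−ρ) ≤ dist1 < θ}`, `μ_F(univ) = haar{dist1 ≤ 2 sin(S∕2)}` — BOTH POSITIVE
(`dist1` takes every value in `[0, 2]`, Haar charges open sets) and `≤ 1`.  (§3) Headline at S88's scale:
`slotAC_final_toy_quarter_live` = S88's `slotAC_final_toy` BY NAME ∧ POSITIVE shell mass, and `toy_shellMass_quarter_eq` = the
shell mass S88's header left uncomputed, as a one-link class mass.  The companion file 3 `ShellMeasureLandauEndFinalToyRho`
re-applies the END with `ρ ∈ [0, ¼]` SYMBOLIC, so that at `ρ = 1∕20` (`D·ρ = 3∕5 < 1`, `toy_D_mul_rho`) the inequality is NOT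
implied by monotonicity while the shell stays live.
NOTHING in the countdown moves; NE7c NOT PROVED; spine PROVED 0∕9.  HONEST DEPENDENCY (cell): continuum YM on T⁴ ⇐ BetaPertH ∧
nine spine estimates (0/9 proved); BetaPertH ⇐ (D1) ∧ (D4) ∧ CAP+tail; G-an2-4 gates asym, D1 and NE2/3/4.
-/

noncomputable section

open Set Metric NormedSpace MeasureTheory Function

namespace Summit.QuantumFields.BalabanUV.T4Continuum.ShellMeasureLandauEndFinalToyMass

open scoped ENNReal Matrix.Norms.L2Operator
open Literature.MathematicalPhysics.QuantumFieldTheory.Balaban1983to89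
open GaugeField (plaqHol)
open T4ShellMeasure (SlotAntiConcentration)
open T4CubeChartGnomonic (SU2)
open T4WilsonLinkAffine (bond₁ bond₂ bond₃ bond₄ bond₁_ne_bond₂ bond₁_ne_bond₃ bond₁_ne_bond₄ plaqHol_eq_letters)
open ShellMeasureLandauEndFinalToy (b₁ staple toyF toyU toyεθ measurable_toyU toyεθ_pos slotAC_final_toy toy_threshold_lt_window)
open ShellMeasureLevelZeroShellMass (continuous_dist1_su2 isOpen_dist1_lt exists_dist1_eq haar_pos_of_isOpen)

/-! ## §0 (M1) is automatic when `1 ≤ D·ρ` -/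

section Automatic

variable {Ω : Type*} [MeasurableSpace Ω]

/-- **(M1) IS IMPLIED BY MONOTONICITY WHEN `1 ≤ D·ρ`.**  `SlotAntiConcentration μ u θ ρ D` reads
`μ{θ(1−ρ) ≤ u < θ} ≤ ofReal(D·ρ)·μ(univ)`; if `1 ≤ D·ρ` this follows from `μ(shell) ≤ μ(univ)` for EVERY measure and
variable.  (At the G-1 certificates' numbers `ρ = ¼`, `D ≥ 4m₀ ≥ 12`: the inequality carries no information there; what
they certify is joint inhabitation of the END's binders.) [folklore] -/
theorem slotAntiConcentration_of_one_le_mul (μ : Measure Ω) (u : Ω → ℝ) (θ : ℝ) {ρ D : ℝ} (h : 1 ≤ D * ρ) :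
    SlotAntiConcentration μ u θ ρ D := by
  unfold SlotAntiConcentration
  calc μ {x | θ * (1 - ρ) ≤ u x ∧ u x < θ} ≤ μ univ := measure_mono (subset_univ _)
    _ = 1 * μ univ := (one_mul _).symm
    _ ≤ ENNReal.ofReal (D * ρ) * μ univ := by
        gcongr
        rw [← ENNReal.ofReal_one]
        exact ENNReal.ofReal_le_ofReal h

/-- S88's numbers: a chart of `Λ = {b₁}` has `m₀ = 3` coordinates … [folklore] -/
theorem m₀_eq_three {P : Params} {j : ℕ} (p : Plaq P j) {m₀ : ℕ}
    (e : ↥({b₁ p} : Finset (PBond P j)) × Fin 3 ≃ Fin m₀) : m₀ = 3 := by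
  have h := Fintype.card_congr e
  simp only [Fintype.card_prod, Fintype.card_coe, Finset.card_singleton, Fintype.card_fin, one_mul] at h
  exact h.symm

/-- … so S88's `slotAC_final_toy` fires the END at `D·ρ = (2(m₀ + 0 + 0)∕(1 − ½))·¼ = 3 ≥ 1`: its (M1) CONCLUSION is
automatic (§0) — the certificate's content is the joint inhabitation of the hypotheses. [folklore] -/
theorem toy_D_mul_quarter {P : Params} {j : ℕ} (p : Plaq P j) {m₀ : ℕ}
    (e : ↥({b₁ p} : Finset (PBond P j)) × Fin 3 ≃ Fin m₀) :
    2 * ((m₀ : ℝ) + (0 + 0)) / (1 - 1 / 2) * (1 / 4) = 3 := by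
  rw [m₀_eq_three p e]; norm_num

/-- … while at `ρ = 1∕20` the same constant gives `D·ρ = 3∕5 < 1` (the instance of file 3 `ShellMeasureLandauEndFinalToyRho`). [folklore] -/
theorem toy_D_mul_rho {P : Params} {j : ℕ} (p : Plaq P j) {m₀ : ℕ}
    (e : ↥({b₁ p} : Finset (PBond P j)) × Fin 3 ≃ Fin m₀) :
    2 * ((m₀ : ℝ) + (0 + 0)) / (1 - 1 / 2) * (1 / 20) < 1 := by
  rw [m₀_eq_three p e]; norm_num

end Automatic

/-! ## §1 The law of one plaquette variable under product Haar is Haar -/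

section Law

variable {P : Params} {j : ℕ}

/-- `U(∂p) = U(b₁)·staple U p` — the plaquette variable through its FIRST letter (S88's `staple`). [folklore] -/
theorem plaqHol_eq_mul_staple (U : GaugeField P j SU2) (p : Plaq P j) :
    plaqHol U p = U (b₁ p) * staple U p := by
  rw [plaqHol_eq_letters]
  simp only [staple, b₁, bond₁, bond₂, bond₃, bond₄, mul_assoc]

/-- the staple is blind to the first letter: letters 2, 3, 4 differ from letter 1 on every torus of the cell
(`T4WilsonLinkAffine.bond₁_ne_bond₂∕₃∕₄`). [folklore] -/
theorem staple_update [DecidableEq (PBond P j)] (U : GaugeField P j SU2) (p : Plaq P j) (g : SU2) :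
    staple (Function.update U (b₁ p) g) p = staple U p := by
  have h2 : bond₂ p ≠ b₁ p := (bond₁_ne_bond₂ p).symm
  have h3 : bond₃ p ≠ b₁ p := (bond₁_ne_bond₃ p).symm
  have h4 : bond₄ p ≠ b₁ p := (bond₁_ne_bond₄ p).symm
  show Function.update U (b₁ p) g (bond₂ p) * (Function.update U (b₁ p) g (bond₃ p))⁻¹ *
      (Function.update U (b₁ p) g (bond₄ p))⁻¹ = U (bond₂ p) * (U (bond₃ p))⁻¹ * (U (bond₄ p))⁻¹
  rw [Function.update_of_ne h2, Function.update_of_ne h3, Function.update_of_ne h4]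

/-- slicing the event `{U(∂p) ∈ A}` along the first letter at a frozen configuration `x`: it is the right
translate `{g' | g'·staple x p ∈ A}` of the one-link event. [folklore] -/
theorem indicator_plaqHol_update [DecidableEq (PBond P j)] (x : GaugeField P j SU2) (p : Plaq P j) (A : Set SU2)
    (g' : SU2) :
    ((fun U : GaugeField P j SU2 => plaqHol U p) ⁻¹' A).indicator (1 : GaugeField P j SU2 → ℝ≥0∞)
        (Function.update x (b₁ p) g') = ((fun h : SU2 => h * staple x p) ⁻¹' A).indicator 1 g' := by
  have e1 : plaqHol (Function.update x (b₁ p) g') p = g' * staple x p := by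
    rw [plaqHol_eq_mul_staple, staple_update, Function.update_self]
  by_cases hg' : g' * staple x p ∈ A
  · rw [Set.indicator_of_mem (show g' ∈ (fun h : SU2 => h * staple x p) ⁻¹' A from hg')]
    exact Set.indicator_of_mem (s := (fun U : GaugeField P j SU2 => plaqHol U p) ⁻¹' A)
      (a := (Function.update x (b₁ p) g' : GaugeField P j SU2))
      (show plaqHol (Function.update x (b₁ p) g') p ∈ A by rw [e1]; exact hg') _
  · rw [Set.indicator_of_notMem (show g' ∉ (fun h : SU2 => h * staple x p) ⁻¹' A from hg')]
    exact Set.indicator_of_notMem (s := (fun U : GaugeField P j SU2 => plaqHol U p) ⁻¹' A)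
      (a := (Function.update x (b₁ p) g' : GaugeField P j SU2))
      (show ¬ plaqHol (Function.update x (b₁ p) g') p ∈ A by rw [e1]; exact hg') _

/-- slicing the one-link event `{U(b₁) ∈ A}` along the first letter. [folklore] -/
theorem indicator_eval_update [DecidableEq (PBond P j)] (x : GaugeField P j SU2) (p : Plaq P j) (A : Set SU2)
    (g' : SU2) :
    ((fun U : GaugeField P j SU2 => U (b₁ p)) ⁻¹' A).indicator (1 : GaugeField P j SU2 → ℝ≥0∞)
        (Function.update x (b₁ p) g') = A.indicator 1 g' := by
  by_cases hg' : g' ∈ A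
  · rw [Set.indicator_of_mem hg']
    exact Set.indicator_of_mem (s := (fun U : GaugeField P j SU2 => U (b₁ p)) ⁻¹' A)
      (a := (Function.update x (b₁ p) g' : GaugeField P j SU2))
      (show Function.update x (b₁ p) g' (b₁ p) ∈ A by rw [Function.update_self]; exact hg') _
  · rw [Set.indicator_of_notMem hg']
    exact Set.indicator_of_notMem (s := (fun U : GaugeField P j SU2 => U (b₁ p)) ⁻¹' A)
      (a := (Function.update x (b₁ p) g' : GaugeField P j SU2))
      (show ¬ Function.update x (b₁ p) g' (b₁ p) ∈ A by rw [Function.update_self]; exact hg') _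

/-- **THE LAW OF ONE PLAQUETTE VARIABLE UNDER PRODUCT HAAR IS HAAR.**  On every torus `T^{(j)}` of the cell, for every
plaquette `p` and every measurable `A ⊆ SU(2)`: `dU{U | U(∂p) ∈ A} = haar(A)`.  Proof: the integrals of the two indicators
`𝟙_A(U(∂p))` and `𝟙_A(U(b₁))` against `dU = Π_b haar` agree because their one-variable marginals along `b₁` agree at every
frozen configuration (`lintegral_eq_of_lmarginal_eq`): the first is `haar{g' | g'·staple ∈ A} = haar(A)` by RIGHT invariance
(`HaarData.map_mul_right`), the second is `haar(A)`; and `dU{U(b₁) ∈ A} = haar(A)` (`AveragingRT.measurePreserving_eval`). [folklore] -/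
theorem fieldMeasure_plaqHol_mem (p : Plaq P j) {A : Set SU2} (hA : MeasurableSet A) :
    fieldMeasure P j SU2 {U | plaqHol U p ∈ A} = (HaarData.haar : Measure SU2) A := by
  classical
  let μ : PBond P j → Measure SU2 := fun _ => HaarData.haar
  let f : GaugeField P j SU2 → ℝ≥0∞ := ((fun U : GaugeField P j SU2 => plaqHol U p) ⁻¹' A).indicator 1
  let g : GaugeField P j SU2 → ℝ≥0∞ := ((fun U : GaugeField P j SU2 => U (b₁ p)) ⁻¹' A).indicator 1
  have hf : Measurable f := measurable_one.indicator ((Missing.measurable_plaqHol p) hA)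
  have hg : Measurable g := measurable_one.indicator ((Missing.measurable_eval (b₁ p)) hA)
  have hs : ∀ x : GaugeField P j SU2, Measurable fun g' : SU2 => g' * staple x p := fun x => measurable_mul_const _
  have key : ∫⋯∫⁻_{b₁ p}, f ∂μ = ∫⋯∫⁻_{b₁ p}, g ∂μ := by
    rw [lmarginal_singleton, lmarginal_singleton]
    funext x
    calc ∫⁻ g', f (Function.update x (b₁ p) g') ∂(μ (b₁ p))
        = ∫⁻ g', ((fun h : SU2 => h * staple x p) ⁻¹' A).indicator 1 g' ∂HaarData.haar :=
          lintegral_congr fun g' => indicator_plaqHol_update x p A g'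
      _ = (HaarData.haar : Measure SU2) ((fun h : SU2 => h * staple x p) ⁻¹' A) := lintegral_indicator_one ((hs x) hA)
      _ = (HaarData.haar : Measure SU2) A := by rw [← Measure.map_apply (hs x) hA, HaarData.map_mul_right]
      _ = ∫⁻ g', A.indicator 1 g' ∂HaarData.haar := (lintegral_indicator_one hA).symm
      _ = ∫⁻ g', g (Function.update x (b₁ p) g') ∂(μ (b₁ p)) :=
          lintegral_congr fun g' => (indicator_eval_update x p A g').symm
  have hint : ∫⁻ U, f U ∂(fieldMeasure P j SU2) = ∫⁻ U, g U ∂(fieldMeasure P j SU2) :=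
    lintegral_eq_of_lmarginal_eq {b₁ p} hf hg key
  have hL : ∫⁻ U, f U ∂(fieldMeasure P j SU2) = fieldMeasure P j SU2 {U | plaqHol U p ∈ A} :=
    lintegral_indicator_one ((Missing.measurable_plaqHol p) hA)
  have hR : ∫⁻ U, g U ∂(fieldMeasure P j SU2) = (HaarData.haar : Measure SU2) A :=
    (lintegral_indicator_one ((Missing.measurable_eval (b₁ p)) hA)).trans
      ((AveragingRT.measurePreserving_eval (P := P) (j := j) (G := SU2) (b₁ p)).measure_preimage
        hA.nullMeasurableSet)
  rw [← hL, hint, hR]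

/-- … in `Measure.map` form: the push-forward of `dU` under `U ↦ U(∂p)` IS the Haar measure of `SU(2)`. [folklore] -/
theorem map_plaqHol_fieldMeasure (p : Plaq P j) :
    (fieldMeasure P j SU2).map (fun U => plaqHol U p) = (HaarData.haar : Measure SU2) := by
  ext A hA
  rw [Measure.map_apply (Missing.measurable_plaqHol p) hA]
  exact fieldMeasure_plaqHol_mem p hA

end Law

/-! ## §2 The toy's realized masses are one-link class masses -/

section Masses

variable {P : Params} {j : ℕ}

/-- the one-link shell `{a ≤ dist1 < b}` is measurable (`dist1` is measurable: `RegularGaugeGroup`). [folklore] -/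
theorem measurableSet_dist1_window (a b : ℝ) : MeasurableSet {g : SU2 | a ≤ dist1 g ∧ dist1 g < b} :=
  (measurableSet_le measurable_const RegularGaugeGroup.measurable_dist1).inter
    (measurableSet_lt RegularGaugeGroup.measurable_dist1 measurable_const)

/-- the classifier shell of the toy is the plaquette-variable preimage of the one-link shell, so its product-Haar mass is
the ONE-LINK class mass `haar{a ≤ dist1 < b}`. [folklore] -/
theorem fieldMeasure_toyShell (p : Plaq P j) (a b : ℝ) :
    fieldMeasure P j SU2 {U | a ≤ toyU p U ∧ toyU p U < b} =
      (HaarData.haar : Measure SU2) {g | a ≤ dist1 g ∧ dist1 g < b} :=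
  fieldMeasure_plaqHol_mem p (measurableSet_dist1_window a b)

/-- the toy density is the indicator of the window event `{dist1 U(∂p) ≤ 2 sin(S∕2)}`. [folklore] -/
theorem toyF_eq_indicator (S : ℝ) (p : Plaq P j) :
    toyF S p = {U : GaugeField P j SU2 | dist1 (plaqHol U p) ≤ 2 * Real.sin (S / 2)}.indicator 1 := by
  funext U
  by_cases h : dist1 (plaqHol U p) ≤ 2 * Real.sin (S / 2)
  · rw [Set.indicator_of_mem (s := {U : GaugeField P j SU2 | dist1 (plaqHol U p) ≤ 2 * Real.sin (S / 2)}) h,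
      Pi.one_apply]
    exact if_pos h
  · rw [Set.indicator_of_notMem (s := {U : GaugeField P j SU2 | dist1 (plaqHol U p) ≤ 2 * Real.sin (S / 2)}) h]
    exact if_neg h

/-- the window event is measurable. [folklore] -/
theorem measurableSet_window (S : ℝ) (p : Plaq P j) :
    MeasurableSet {U : GaugeField P j SU2 | dist1 (plaqHol U p) ≤ 2 * Real.sin (S / 2)} :=
  measurableSet_le (RegularGaugeGroup.measurable_dist1.comp (Missing.measurable_plaqHol p)) measurable_const

/-- **TOTAL MASS**: `μ_F(univ) = dU{dist1 U(∂p) ≤ 2 sin(S∕2)} = haar{dist1 ≤ 2 sin(S∕2)}`. [folklore] -/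
theorem toy_totalMass_eq (S : ℝ) (p : Plaq P j) :
    ((fieldMeasure P j SU2).withDensity (toyF S p)) univ =
      (HaarData.haar : Measure SU2) {g | dist1 g ≤ 2 * Real.sin (S / 2)} := by
  rw [withDensity_apply _ MeasurableSet.univ, Measure.restrict_univ, toyF_eq_indicator,
    lintegral_indicator_one (measurableSet_window S p)]
  exact fieldMeasure_plaqHol_mem p (measurableSet_le RegularGaugeGroup.measurable_dist1 measurable_const)

/-- on an event inside the window the density is `1`, so its realized mass is its product-Haar mass. [folklore] -/
theorem toy_withDensity_apply_of_subset {S : ℝ} (p : Plaq P j) {B : Set (GaugeField P j SU2)} (hB : MeasurableSet B)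
    (hBW : B ⊆ {U | dist1 (plaqHol U p) ≤ 2 * Real.sin (S / 2)}) :
    ((fieldMeasure P j SU2).withDensity (toyF S p)) B = fieldMeasure P j SU2 B := by
  rw [withDensity_apply _ hB]
  calc ∫⁻ U in B, toyF S p U ∂fieldMeasure P j SU2 = ∫⁻ _ in B, 1 ∂fieldMeasure P j SU2 :=
        setLIntegral_congr_fun hB fun U hU => by
          rw [toyF_eq_indicator, Set.indicator_of_mem (show U ∈ {U : GaugeField P j SU2 | _} from hBW hU),
            Pi.one_apply]
    _ = fieldMeasure P j SU2 B := by rw [setLIntegral_const, one_mul]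

/-- the classifier shell is measurable. [folklore] -/
theorem measurableSet_toyShell (p : Plaq P j) (a b : ℝ) :
    MeasurableSet {U : GaugeField P j SU2 | a ≤ toyU p U ∧ toyU p U < b} :=
  (measurableSet_le measurable_const (measurable_toyU p)).inter (measurableSet_lt (measurable_toyU p) measurable_const)

/-- **SHELL MASS, EXACTLY**: if the threshold sits inside the window (`θ ≤ 2 sin(S∕2)`), the realized mass of the shell
`{θ(1−ρ) ≤ u < θ}` is the one-link class mass `haar{θ(1−ρ) ≤ dist1 < θ}`. [folklore] -/
theorem toy_shellMass_eq {S θ : ℝ} (p : Plaq P j) (hθ : θ ≤ 2 * Real.sin (S / 2)) (ρ : ℝ) :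
    ((fieldMeasure P j SU2).withDensity (toyF S p)) {U | θ * (1 - ρ) ≤ toyU p U ∧ toyU p U < θ} =
      (HaarData.haar : Measure SU2) {g | θ * (1 - ρ) ≤ dist1 g ∧ dist1 g < θ} := by
  rw [toy_withDensity_apply_of_subset p (measurableSet_toyShell p _ _) fun U hU => ?_, fieldMeasure_toyShell]
  exact (le_of_lt hU.2).trans hθ

/-- the one-link shell `{a ≤ dist1 < b}` with `0 ≤ a < b`, `a < 2` has POSITIVE Haar mass: it contains the open set
`{a < dist1 < b}`, nonempty since `dist1` takes the value `min((a+b)∕2, (a+2)∕2) ∈ [0, 2]`. [folklore] -/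
theorem haar_shell_pos {a b : ℝ} (ha : 0 ≤ a) (hab : a < b) (ha2 : a < 2) :
    0 < (HaarData.haar : Measure SU2) {g | a ≤ dist1 g ∧ dist1 g < b} := by
  set c : ℝ := min ((a + b) / 2) ((a + 2) / 2) with hc
  have hca : a < c := lt_min (by linarith) (by linarith)
  have hcb : c < b := (min_le_left _ _).trans_lt (by linarith)
  have hc2 : c ≤ 2 := (min_le_right _ _).trans (by linarith)
  obtain ⟨g₀, hg₀⟩ := exists_dist1_eq (ha.trans hca.le) hc2
  have hopen : IsOpen {g : SU2 | a < dist1 g ∧ dist1 g < b} :=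
    (isOpen_lt continuous_const continuous_dist1_su2).inter (isOpen_lt continuous_dist1_su2 continuous_const)
  have hne : ({g : SU2 | a < dist1 g ∧ dist1 g < b}).Nonempty := ⟨g₀, by simp only [mem_setOf_eq, hg₀]; exact ⟨hca, hcb⟩⟩
  exact (haar_pos_of_isOpen hopen hne).trans_le (measure_mono fun g hg => ⟨hg.1.le, hg.2⟩)

/-- the one-link window `{dist1 ≤ r}` with `0 < r` has POSITIVE Haar mass (it contains the open neighbourhood
`{dist1 < r}` of `1`). [folklore] -/
theorem haar_window_pos {r : ℝ} (hr : 0 < r) : 0 < (HaarData.haar : Measure SU2) {g | dist1 g ≤ r} :=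
  (haar_pos_of_isOpen (isOpen_dist1_lt r) ⟨1, by simp [GaugeGroup.dist1_one, hr]⟩).trans_le
    (measure_mono fun g (hg : dist1 g < r) => show dist1 g ≤ r from hg.le)

/-- `0 < 2 sin(S∕2)` (stated for the toy's windows `0 < S < 1∕6`). [folklore] -/
theorem two_sin_half_pos {S : ℝ} (hS : 0 < S) (hS6 : S < 1 / 6) : 0 < 2 * Real.sin (S / 2) := by
  have := Real.sin_pos_of_pos_of_lt_pi (by linarith : 0 < S / 2) (by linarith [Real.pi_gt_three] : S / 2 < Real.pi)
  linarith

/-- **THE TOY'S TOTAL MASS IS IN `(0, 1]`** (`0 < S < 1∕6`). [folklore] -/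
theorem toy_totalMass_pos_le_one {S : ℝ} (hS : 0 < S) (hS6 : S < 1 / 6) (p : Plaq P j) :
    0 < ((fieldMeasure P j SU2).withDensity (toyF S p)) univ ∧ ((fieldMeasure P j SU2).withDensity (toyF S p)) univ ≤ 1 := by
  rw [toy_totalMass_eq]
  exact ⟨haar_window_pos (two_sin_half_pos hS hS6), prob_le_one⟩

/-- **THE LIVE SHELL OF THE END-II-final TOY HAS POSITIVE REALIZED MASS** (`0 < S ≤ 10⁻⁵`, `0 < ρ ≤ 1`): by S88 §5 the
threshold `θ = εθ·1²` is `< 2 sin(S∕2)`, so the shell mass is the one-link class mass `haar{θ(1−ρ) ≤ dist1 < θ} > 0`. [folklore] -/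
theorem toy_shellMass_pos {S : ℝ} (hS : 0 < S) (hS5 : S ≤ 1 / 100000) (p : Plaq P j) {ρ : ℝ} (hρ : 0 < ρ) (hρ1 : ρ ≤ 1) :
    0 < ((fieldMeasure P j SU2).withDensity (toyF S p))
      {U | toyεθ S * 1 ^ 2 * (1 - ρ) ≤ toyU p U ∧ toyU p U < toyεθ S * 1 ^ 2} := by
  have hθ := toy_threshold_lt_window hS hS5
  have hθ0 : 0 < toyεθ S * 1 ^ 2 := by rw [one_pow, mul_one]; exact toyεθ_pos hS (by linarith)
  have hsin : 2 * Real.sin (S / 2) ≤ 2 := by linarith [Real.sin_le_one (S / 2)]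
  rw [toy_shellMass_eq p hθ.le]
  exact haar_shell_pos (by nlinarith) (by nlinarith) (by nlinarith)

end Masses

/-! ## §3 Headline at S88's scale `ρ = ¼`: the certified (M1)'s shell is LIVE -/

section Live

variable {P : Params} {j : ℕ} [DecidableEq (PBond P j)]

/-- **ROW S88, MEASURE HALF, AT THE CERTIFIED SCALE `ρ = ¼`**: for `0 < S ≤ 10⁻⁵`, S88's `slotAC_final_toy` (BY NAME) AND the
certified shell `{¾θ ≤ u < θ}` has POSITIVE realized mass (§2) — the typer's acceptance clause «realized shell mass POSITIVE (not
the `F = 0` ∕ empty-shell instance)» for row S88, met in kernel.  (By §0 the inequality itself is automatic at `D·ρ = 3`; the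
`ρ`-symbolic instance with `D·ρ < 1` is file 3 `ShellMeasureLandauEndFinalToyRho`.)  NE7c NOT PROVED. [folklore] -/
theorem slotAC_final_toy_quarter_live (p : Plaq P j) {m₀ : ℕ} (e : ↥({b₁ p} : Finset (PBond P j)) × Fin 3 ≃ Fin m₀)
    {S : ℝ} (hS : 0 < S) (hS5 : S ≤ 1 / 100000) :
    SlotAntiConcentration ((fieldMeasure P j SU2).withDensity (toyF S p)) (toyU p) (toyεθ S * 1 ^ 2) (1 / 4)
        (2 * ((m₀ : ℝ) + (0 + 0)) / (1 - 1 / 2)) ∧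
      0 < ((fieldMeasure P j SU2).withDensity (toyF S p))
        {U | toyεθ S * 1 ^ 2 * (1 - 1 / 4) ≤ toyU p U ∧ toyU p U < toyεθ S * 1 ^ 2} :=
  ⟨slotAC_final_toy p e hS (by linarith), toy_shellMass_pos hS hS5 p (by norm_num) (by norm_num)⟩

omit [DecidableEq (PBond P j)] in
/-- **THE SHELL MASS AS A NUMBER-FREE IDENTITY** at S88's scale: for `0 < S ≤ 10⁻⁵` the realized mass of the certified shell
IS `haar{¾θ ≤ dist1 < θ}`, `θ = 144∕(1∕(6S) − 1)²` — the «Haar mass of the shell» S88's header left uncomputed, in closed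
form as a one-link class mass. [folklore] -/
theorem toy_shellMass_quarter_eq {S : ℝ} (hS : 0 < S) (hS5 : S ≤ 1 / 100000) (p : Plaq P j) :
    ((fieldMeasure P j SU2).withDensity (toyF S p))
        {U | toyεθ S * 1 ^ 2 * (1 - 1 / 4) ≤ toyU p U ∧ toyU p U < toyεθ S * 1 ^ 2} =
      (HaarData.haar : Measure SU2) {g | toyεθ S * 1 ^ 2 * (1 - 1 / 4) ≤ dist1 g ∧ dist1 g < toyεθ S * 1 ^ 2} :=
  toy_shellMass_eq p (toy_threshold_lt_window hS hS5).le (1 / 4)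

end Live

end Summit.QuantumFields.BalabanUV.T4Continuum.ShellMeasureLandauEndFinalToyMass

end
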